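import Summits.BirchSwinnertonDyer.BirchSwinnertonDyer.Theses.KatoDescentPotSupersingular
import Summits.BirchSwinnertonDyer.Rank1Residual.O6.X3WildOfKMCTorsionFreeMember
import HarnessLib

/-!
# Route `KatoDescentPotSupersingular` (rung K9, cell `bsd-potss`): the crux `WildUpperReducibleDefect`
# (U₀-red, item stmt-BirchSwinnertonDyer-19190) is a SHADOW OF KATO'S MAIN CONJECTURE 12.10 at the
# `3`-torsion-free members — it follows from KMC₃ there over the image-free readings (a `--supports` file;
# the item is NOT closed)

The rows of the crux: `E/ℚ` globally minimal, wild additive potentially supersingular at `3` (`ClassO6 W 3`),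
analytic rank `0`, `E[3]` REDUCIBLE, and the member bound `ReducibleKatoMember` (T-X3K, item 19196) does
NOT reach the pair: the isogeny class has a member with a rational point of order `9`, or `ord₃ #Ш_an(E)`
is odd. What the member bound gives there (o6-r1 GEN 21, `O6/X3KatoMemberBound.lean`): at Kato's member
`W_K` the slack is `t(W_K) = ord₃ #W_K(ℚ)_tors ≤ 2` (the cokernel of Greenberg's Prop. 4.13), the defect
`δ = ord₃ #Ш − ord₃ #Ш_an` is class-constant (Cassels) and even when `ord₃ #Ш_an` is even (Cassels–Tate),
so the rows left are exactly "`W_K` is the `ℤ/9`-member" (`δ ∈ {0, 2}`) and "`ord₃ #Ш_an` odd" (`δ` odd —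
empty under BSD, untouched by any upper bound). BOTH follow from Kato's Main Conjecture 12.10 for `T₃W′`
at a `3`-TORSION-FREE member `W′` of the class — which EXISTS (isogeny walk + Mazur–Kenku,
`Addv.exists_torsionFree_member`, kmc part 10) — over the kmc seat's image-free readings 1♭/3♭, the
interface lemma `ReadsTrivialKMC`, Cassels' isogeny invariance, GZK and modularity: KMC₃(W′) ⇒ `BSD(W′,3)`
(`TorsionFree.bsdp_rankZero_of_kmc`, both halves, image-free) ⇒ `BSD(W,3)` (Cassels) ⇒ the upper half at
`W`. This is the U₀-red twin of the route's L₀ glue `O6.wildLowerHalfRankZero_of_kmc_torsionFree`.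
CONDITIONAL over displayed hypotheses (`proof.conditional`); KMC is the hypothesis `hK` (asked only at
torsion-free members of the classes of the item's rows), D-O6-2 stands, nothing is credited; the item is
NOT closed. Seat `bsd-potss-k9-c4`.

References: [Kato2004Asterisque] Conj. 12.10 (p. 224), §14.14 and Lemma 14.15 (pp. 243–244), Prop. 14.16
(2) (p. 244); [Cassels1965ArithmeticVIII]; [SilvermanAEC2009] IX.6 Example 6.4 (Mazur–Kenku);
[Miller2011LMS] Def. 1.1.
-/

set_option autoImplicit false
-- sibling precedent (`KatoDescentPotSupersingularAssembly.lean`): the directory name repeats the summit name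
set_option linter.dupNamespace false

noncomputable section

open scoped Classical

namespace Summit.BirchSwinnertonDyer.BirchSwinnertonDyer.Theorems

open WeierstrassCurve Literature.NumberTheory.EllipticCurves
  Literature.NumberTheory.EllipticCurves.Rank1Residual
  Literature.NumberTheory.EllipticCurves.Rank1Residual.Typed
  Summit.BirchSwinnertonDyer.Rank1Residual.Additive
  Summit.BirchSwinnertonDyer.Rank1Residual
  Summit.BirchSwinnertonDyer.BirchSwinnertonDyer.Theses.KatoDescentPotSupersingular

variable {IsOf : ∀ (W : WeierstrassCurve ℚ) [W.IsElliptic] [W.IsGloballyMinimal] (p : ℕ) [Fact p.Prime],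
  KatoDescentDatum p → Prop}
variable {KMC : ∀ (W : WeierstrassCurve ℚ) [W.IsElliptic] [W.IsGloballyMinimal] (p : ℕ), Prop}

/-- **The UPPER half at a wild rank-`0` pair from KMC₃ at the `3`-torsion-free members of ITS class**
(reducible or not, defect row or not): for `W` globally minimal with `r_an = 0` and `ClassO6 W 3`, granted
Kato's Main Conjecture 12.10 for `T₃W′` at every `3`-torsion-free additive potentially good `W′ ∼ W`
(such a member exists: `Addv.exists_torsionFree_member`, Mazur–Kenku `hMK`), the image-free readings
1♭/3♭ and the interface lemma, Cassels, GZK, modularity: `MissingUpperBoundAt W 3` — KMC₃(W′) ⇒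
`BSD(W′,3)` ⇒ `BSD(W,3)` ⇒ both halves at `W`. [cite: Kato2004Asterisque, Conj. 12.10 (p. 224), Prop. 14.16 (2) (p. 244)]
[cite: Cassels1965ArithmeticVIII] [cite: SilvermanAEC2009, IX.6 Example 6.4] -/
theorem missingUpperBoundAt_wild_of_kmc_torsionFree (hR : TorsionFree.DescentCountReading IsOf)
    (hreal : TorsionFree.RealizableOfKMC IsOf KMC) (hread : ReadsTrivialKMC IsOf KMC)
    (hCassels : bsdRHS_eq_of_isIsogenous) (hGZK : rank_eq_analyticRank_of_analyticRank_le_one)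
    (hmod : hasEntireLFunction_rat) (hMK : mazurKenku_exists_cyclic_isogeny)
    (W : WeierstrassCurve ℚ) [W.IsElliptic] [W.IsGloballyMinimal] [Fact (3 : ℕ).Prime]
    (hr : W.analyticRank = 0) (hO : ClassO6 W 3)
    (hK : ∀ (W' : WeierstrassCurve ℚ) [W'.IsElliptic] [W'.IsGloballyMinimal],
      IsIsogenous W W' → Addv W' 3 → 0 ≤ padicValRat 3 W'.j → ¬ 3 ∣ W'.torsionOrder → KMC W' 3) :
    MissingUpperBoundAt W 3 := by
  obtain ⟨W', hW', hM', hiso, hadd', hj', ht'⟩ :=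
    Addv.exists_torsionFree_member hMK (by decide) hO.2.1 hO.padicValRat_j_nonneg
  haveI := hW'
  haveI := hM'
  have hbsd : BSDp W 3 := TorsionFree.bsdp_rankZero_of_isIsogenous_of_kmc hR hreal hread hCassels hGZK
    hmod W W' 3 hiso hr (by decide) hadd' hj' ht' (hK W' hiso hadd' hj' ht')
  haveI : Finite W.sha := (hGZK W (by rw [hr]; exact zero_le_one)).2
  exact (lower_and_upper_of_missingPPartAt W 3 (missingPPartAt_of_bsdp W 3 hbsd)).2

/-- **The crux `WildUpperReducibleDefect` FOLLOWS FROM KMC₃ AT THE `3`-TORSION-FREE MEMBERS of the classes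
of its rows** (the reducible wild rank-`0` classes with a `ℤ/9`-member or odd `ord₃ #Ш_an`), over the
image-free readings 1♭/3♭, the interface lemma `ReadsTrivialKMC`, Cassels, GZK, modularity and Mazur–Kenku
— by the previous theorem with `hK` asked only on the item's rows. The KMC₃ shadow of the item (U₀-red
twin of `O6.wildLowerHalfRankZero_of_kmc_torsionFree`); KMC is the hypothesis, nothing is credited, the
item is not closed. [cite: Kato2004Asterisque, Conj. 12.10 (p. 224), Prop. 14.16 (2) (p. 244)]
[cite: Cassels1965ArithmeticVIII] [cite: SilvermanAEC2009, IX.6 Example 6.4] -/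
theorem wildUpperReducibleDefect_of_kmc_torsionFree (hR : TorsionFree.DescentCountReading IsOf)
    (hreal : TorsionFree.RealizableOfKMC IsOf KMC) (hread : ReadsTrivialKMC IsOf KMC)
    (hCassels : bsdRHS_eq_of_isIsogenous) (hGZK : rank_eq_analyticRank_of_analyticRank_le_one)
    (hmod : hasEntireLFunction_rat) (hMK : mazurKenku_exists_cyclic_isogeny)
    (hK : ∀ (W W' : WeierstrassCurve ℚ) [W.IsElliptic] [W.IsGloballyMinimal] [W'.IsElliptic]
      [W'.IsGloballyMinimal],
      W.analyticRank = 0 → ClassO6 W 3 → ¬ W.HasIrreducibleModPGaloisRep 3 →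
      ¬ ((∀ (W'' : WeierstrassCurve ℚ) [W''.IsElliptic], IsIsogenous W W'' → ¬ 3 ^ 2 ∣ W''.torsionOrder) ∧
          ∀ q : ℚ, shaAn W = (q : ℂ) → Even (padicValRat 3 q)) →
      IsIsogenous W W' → Addv W' 3 → 0 ≤ padicValRat 3 W'.j → ¬ 3 ∣ W'.torsionOrder → KMC W' 3) :
    Summit.BirchSwinnertonDyer.BirchSwinnertonDyer.Theses.KatoDescentPotSupersingular.WildUpperReducibleDefect := by
  intro W _ _ _ hr hO hred hdef
  exact missingUpperBoundAt_wild_of_kmc_torsionFree hR hreal hread hCassels hGZK hmod hMK W hr hO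
    (fun W' _ _ hiso hadd' hj' ht' ↦ hK W W' hr hO hred hdef hiso hadd' hj' ht')

end Summit.BirchSwinnertonDyer.BirchSwinnertonDyer.Theorems

end
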